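import Summits.QuantumFields.BalabanUV.Beta.D1BFx.LatticeHLS
import Literature.MathematicalPhysics.QuantumFieldTheory.Balaban1983to89.Beta.DyadicShell

/-!
# `BalabanUV.Beta.D1BFx.LatticeHLSProfiles` — road «BF-x» for binder row D1, letter (L5) of the gluon needle rows T₁∕T₂∕T₃ (owner spec
# `GLUON-NEEDLE-ROWS.md` v0.1 ∕ ruling ρ-g9-33, claimable «GN-L5 HLS KIT»), PART 3 of 3: THE PACKAGED KERNEL∘PROFILE BOUNDS `|Σ_x K(x)·f(x)|`
# (owner ρ-g10-1 (N2)), the DAMPING-CENTRE-FREE one-centre sums (an3 [AN3-G58-GNL5-2] (b′)), the `Summable`∕`tsum` forms, and the `d = 4` reading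

HONEST FRAMING (cell contract, verbatim): «discharging `BetaPertH` makes Bałaban's UV stability UNCONDITIONAL — a real constructive-QFT
result; it is NOT the continuum limit and NOT the Clay problem.»  HONEST DEPENDENCY (verbatim): «continuum YM on T⁴ ⇐ BetaPertH ∧ nine
spine estimates (0/9 proved); BetaPertH ⇐ (D1) ∧ (D4) ∧ CAP+tail; G-an2-4 gates asym, D1 and NE2/3/4.»  THIS MODULE DISCHARGES NOTHING
of D1 ∕ BetaPertH: it is [folklore] bookkeeping over parts 1–2 (`D1BFx.LatticeHLSRadial`, `D1BFx.LatticeHLS`) and Mathlib's summability API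
(`summable_of_sum_le`, `Real.tsum_le_of_sum_le`, `Summable.of_nonneg_of_le`, `norm_tsum_le_tsum_norm`); it cites nothing, mints no `Prop`,
asserts nothing of Bałaban's papers; `K`, `f` below are ARBITRARY functions `Site d → ℝ`; 0 binders; (K) NOT closed; NOT D1, NOT BetaPertH,
NOT continuum, NOT Clay.
WHY.  Owner ρ-g10-1 (N2): «include the packaged kernel∘profile corollaries (the sharp twins of FP's `tsum_kernel_profile_le` ∕ `tsum_profile_profile_le` ∕
`abs_tsum_mul_le_of_profiles`): `(∀ x, |K x| ≤ κ·nrm(x−u)^{−a}) → (∀ x, |f x| ≤ A·nrm(x−v)^{−b}) → |Σ_{x∈S} K x·f x| ≤ κ·A·C_{a,b}·nrm(u−v)^{−(a+b−d)}`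
(+ `tsum`∕`Summable` forms, and the one-damped critical twin) — THIS is the shape the T₃∕T₁∕T₂ files consume at each `𝔅` placement of an3 §3′ (3):
(2,3) ↦ `(Ga∇ρ_u)(ξ) ≤ k n⁻²·nrm(ξ−u)⁻¹`, (3,3) ↦ `(Ga∇δρ_u)(ξ) ≤ k n⁻²·nrm(ξ−u)⁻²`, damped (3,1) ↦ `𝔅(ρ_u,ρ_{u′}) ≤ k n⁻⁴(1 + log n)`».  an3-g58
[AN3-G58-GNL5-2] (3): «ONE SMALL ADDITION, (b′) damping centre free — the shape every consumer meets: `Σ_{x∈S} ‖x−v‖∞^q·nrm(x−u)^{−p}·e^{−(δ∕n)‖x−v‖∞}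
≤ C_{p,q}(δ)·n^{d−p+q}` for `p ≤ d−1`, `q ≥ 0`, ALL `u, v`» (the w-summed booking of the `𝔅(ρ,ρ′)·𝔅(δp,δp′)` pairing of §3′ (4) uses it with p = 1, 2, 3).
CONTENT (all [folklore]; `κ_d := 2d·3^{d−1}`).  §1 (b′): `sum_exp_div_nrm_pow_free_le` (`Σ_{x∈S} e^{−ε‖x−v‖∞}∕nrm(x−u)^p ≤ 2(1 + κ_d (d−1−p)!(2∕ε)^{d−1−p}(1+2∕ε))`,
ALL `u, v`: split at `‖x−u‖∞ ≤ ‖x−v‖∞`), `sum_pow_mul_exp_div_nrm_pow_free_le` (moment `‖x−v‖∞^q` at the price `q!(2∕ε)^q` and half the mass),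
`sum_pow_mul_exp_div_nrm_pow_free_scale_le` (`ε = δ∕n`: `≤ C·n^{d−p+q}`).  §2 (N2): `abs_sum_mul_le_of_profiles` (super-critical `a, b ≤ d−1`, `a+b ≥ d+1`),
`abs_sum_mul_le_of_profiles_crit` (`a+b = d`, the `f`-profile damped at scale `n`).  §3 `Summable`∕`tsum` forms: `tsum_inv_nrm_pow_le`, `tsum_pow_mul_exp_scale_le`,
`tsum_exp_div_nrm_pow_crit_le`, `tsum_inv_nrm_pow_mul_le`, `tsum_exp_div_nrm_pow_mul_crit_le`, `abs_tsum_mul_le_of_profiles(_crit)`.  §4 the `d = 4` reading: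
`DyadicShell.supNorm = PoissonInterior.supNorm` (rfl) and `nrm w = ‖w‖∞` off the origin, so the road's `Pt` letters (`GhostLegFree.ghost_d0∕d1`: `A·e^{−(δ∕n)‖v‖∞}∕‖v‖∞^p`,
`v ≠ 0`; `DiagonalLegGrade`; `FlatGradedCount`'s shells) are profiles in the sense of §2.  Constants explicit and crude.
Unit `b2b-balaban-beta-d1-formalise-leaf-04` (gen 9), claim «GN-L5 HLS KIT» (journal 2026-08-21 l.29970; GO ρ-g10-1 l.30007).
-/

namespace Summit.QuantumFields.BalabanUV.Beta.D1BFx.LatticeHLSProfiles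

open Finset Real
open Literature.Probability.LatticeModels (Site)
open Literature.MathematicalPhysics.QuantumFieldTheory.Balaban1983to89.Beta
open PoissonInterior (supNorm nrm nrm_pos one_le_nrm supNorm_le_nrm)
open LatticeHLSRadial (nrm_eq_max pow_mul_exp_neg_le sum_inv_nrm_pow_le_const sum_pow_mul_exp_scale_le sum_exp_div_nrm_pow_le
  sum_exp_div_nrm_pow_crit_le)
open LatticeHLS (sum_inv_nrm_pow_mul_le sum_exp_div_nrm_pow_mul_crit_le)

variable {d : ℕ}

/-! ## §1 Damping centre free: `Σ_x ‖x−v‖^q e^{−ε‖x−v‖} ∕ nrm(x−u)^p` for ALL `u, v` -/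

/-- [folklore] `nrm` is monotone in the integer sup-norm: `‖y‖∞ ≤ ‖z‖∞ → nrm y ≤ nrm z`. -/
theorem nrm_le_nrm_of_supNorm_le {y z : Site d} (h : supNorm y ≤ supNorm z) : nrm y ≤ nrm z := by
  rw [nrm_eq_max, nrm_eq_max]
  exact max_le_max le_rfl (by exact_mod_cast h)

/-- [folklore] **DAMPING CENTRE FREE, `q = 0`.**  For `p ≤ d−1`, `ε > 0` and ALL centres `u, v`:
`Σ_{x∈S} e^{−ε‖x−v‖∞}∕nrm(x−u)^p ≤ 2·(1 + 2d·3^{d−1}·(d−1−p)!·(2∕ε)^{d−1−p}·(1+2∕ε))` — on `{‖x−u‖∞ ≤ ‖x−v‖∞}` the damping is moved to `u`, on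
the complement the power is moved to `v`; part 1's `sum_exp_div_nrm_pow_le` at each centre. -/
theorem sum_exp_div_nrm_pow_free_le (hd : 0 < d) {ε : ℝ} (hε : 0 < ε) {p : ℕ} (hp : p ≤ d - 1) (S : Finset (Site d)) (u v : Site d) :
    ∑ x ∈ S, Real.exp (-ε * supNorm (x - v)) / nrm (x - u) ^ p
      ≤ 2 * (1 + 2 * d * 3 ^ (d - 1) * ((d - 1 - p).factorial * (2 / ε) ^ (d - 1 - p) * (1 + 2 / ε))) := by
  classical
  rw [← Finset.sum_filter_add_sum_filter_not S (fun x => supNorm (x - u) ≤ supNorm (x - v)), two_mul]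
  refine add_le_add ?_ ?_
  · calc ∑ x ∈ S.filter (fun x => supNorm (x - u) ≤ supNorm (x - v)), Real.exp (-ε * supNorm (x - v)) / nrm (x - u) ^ p
        ≤ ∑ x ∈ S.filter (fun x => supNorm (x - u) ≤ supNorm (x - v)), Real.exp (-ε * supNorm (x - u)) / nrm (x - u) ^ p := by
          refine Finset.sum_le_sum fun x hx => ?_
          have h := (Finset.mem_filter.mp hx).2
          have := nrm_pos (x - u)
          refine div_le_div_of_nonneg_right (Real.exp_le_exp.mpr ?_) (by positivity)
          have : (supNorm (x - u) : ℝ) ≤ supNorm (x - v) := by exact_mod_cast h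
          nlinarith
      _ ≤ _ := sum_exp_div_nrm_pow_le hd hε hp _ u
  · calc ∑ x ∈ S.filter (fun x => ¬supNorm (x - u) ≤ supNorm (x - v)), Real.exp (-ε * supNorm (x - v)) / nrm (x - u) ^ p
        ≤ ∑ x ∈ S.filter (fun x => ¬supNorm (x - u) ≤ supNorm (x - v)), Real.exp (-ε * supNorm (x - v)) / nrm (x - v) ^ p := by
          refine Finset.sum_le_sum fun x hx => ?_
          have h := not_le.mp (Finset.mem_filter.mp hx).2
          have h1 := nrm_pos (x - v)
          have h2 : nrm (x - v) ≤ nrm (x - u) := nrm_le_nrm_of_supNorm_le h.le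
          exact div_le_div_of_nonneg_left (Real.exp_pos _).le (by positivity) (pow_le_pow_left₀ h1.le h2 p)
      _ ≤ _ := sum_exp_div_nrm_pow_le hd hε hp _ v

/-- [folklore] **DAMPING CENTRE FREE, with a moment** (`p ≤ d−1`, `q ≥ 0`, ALL `u, v`):
`Σ_{x∈S} ‖x−v‖∞^q·e^{−ε‖x−v‖∞}∕nrm(x−u)^p ≤ q!(2∕ε)^q · 2·(1 + 2d·3^{d−1}·(d−1−p)!·(4∕ε)^{d−1−p}·(1+4∕ε))` (the moment costs `(2∕ε)^q` and half the
mass, `pow_mul_exp_neg_le`; then the `q = 0` case at `ε∕2`). -/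
theorem sum_pow_mul_exp_div_nrm_pow_free_le (hd : 0 < d) {ε : ℝ} (hε : 0 < ε) {p : ℕ} (hp : p ≤ d - 1) (q : ℕ) (S : Finset (Site d))
    (u v : Site d) :
    ∑ x ∈ S, ((supNorm (x - v) : ℕ) : ℝ) ^ q * Real.exp (-ε * supNorm (x - v)) / nrm (x - u) ^ p
      ≤ q.factorial * (2 / ε) ^ q * (2 * (1 + 2 * d * 3 ^ (d - 1) * ((d - 1 - p).factorial * (4 / ε) ^ (d - 1 - p) * (1 + 4 / ε)))) := by
  have h := sum_exp_div_nrm_pow_free_le hd (ε := ε / 2) (by positivity) hp S u v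
  have e4 : (2 : ℝ) / (ε / 2) = 4 / ε := by field_simp; norm_num
  rw [e4] at h
  calc ∑ x ∈ S, ((supNorm (x - v) : ℕ) : ℝ) ^ q * Real.exp (-ε * supNorm (x - v)) / nrm (x - u) ^ p
      ≤ ∑ x ∈ S, q.factorial * (2 / ε) ^ q * (Real.exp (-(ε / 2) * supNorm (x - v)) / nrm (x - u) ^ p) := by
        refine Finset.sum_le_sum fun x _ => ?_
        have := nrm_pos (x - u)
        rw [← mul_div_assoc]
        exact div_le_div_of_nonneg_right (pow_mul_exp_neg_le hε q (Nat.cast_nonneg _)) (by positivity)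
    _ = q.factorial * (2 / ε) ^ q * ∑ x ∈ S, Real.exp (-(ε / 2) * supNorm (x - v)) / nrm (x - u) ^ p := by rw [Finset.mul_sum]
    _ ≤ _ := mul_le_mul_of_nonneg_left h (by positivity)

/-- [folklore] **DAMPING CENTRE FREE AT SCALE `n`** (an3 (b′) verbatim shape: `ε = δ∕n`, `n ≥ 1`, `p ≤ d−1`, ALL `u, v`):
`Σ_{x∈S} ‖x−v‖∞^q·e^{−(δ∕n)‖x−v‖∞}∕nrm(x−u)^p ≤ C·n^{d−p+q}`, `C = 2·q!·(2∕δ)^q·(1 + 2d·3^{d−1}·(d−1−p)!·(4∕δ)^{d−1−p}·(1+4∕δ))`. -/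
theorem sum_pow_mul_exp_div_nrm_pow_free_scale_le (hd : 0 < d) {δ : ℝ} (hδ : 0 < δ) {n : ℕ} (hn : 1 ≤ n) {p : ℕ} (hp : p ≤ d - 1) (q : ℕ)
    (S : Finset (Site d)) (u v : Site d) :
    ∑ x ∈ S, ((supNorm (x - v) : ℕ) : ℝ) ^ q * Real.exp (-(δ / n) * supNorm (x - v)) / nrm (x - u) ^ p
      ≤ 2 * q.factorial * (2 / δ) ^ q * (1 + 2 * d * 3 ^ (d - 1) * ((d - 1 - p).factorial * (4 / δ) ^ (d - 1 - p) * (1 + 4 / δ)))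
        * (n : ℝ) ^ (d - p + q) := by
  have hn0 : (0 : ℝ) < n := by exact_mod_cast hn
  have hn1 : (1 : ℝ) ≤ n := by exact_mod_cast hn
  have h := sum_pow_mul_exp_div_nrm_pow_free_le hd (ε := δ / n) (by positivity) hp q S u v
  refine le_trans h ?_
  have e2 : (2 : ℝ) / (δ / n) = 2 / δ * n := by field_simp
  have e4 : (4 : ℝ) / (δ / n) = 4 / δ * n := by field_simp
  rw [e2, e4, mul_pow, mul_pow]
  set κ : ℝ := 2 * d * 3 ^ (d - 1) with hκ
  set F : ℝ := ((d - 1 - p).factorial : ℝ) with hF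
  have hκ0 : 0 ≤ κ := by positivity
  have h4δ : (0 : ℝ) ≤ 4 / δ := by positivity
  have hpow1 : (1 : ℝ) ≤ (n : ℝ) ^ (d - 1 - p) := one_le_pow₀ hn1
  have hnn : (n : ℝ) ^ (d - p) = (n : ℝ) ^ (d - 1 - p) * n := by rw [← pow_succ]; congr 1; omega
  -- the `p`-part: `1 + κ F (4/δ)^k n^k (1 + 4/δ n) ≤ (1 + κ F (4/δ)^k (1+4/δ)) n^{d-p}`
  have hP : 1 + κ * (F * ((4 / δ) ^ (d - 1 - p) * (n : ℝ) ^ (d - 1 - p)) * (1 + 4 / δ * n))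
      ≤ (1 + κ * (F * (4 / δ) ^ (d - 1 - p) * (1 + 4 / δ))) * (n : ℝ) ^ (d - p) := by
    rw [hnn, add_mul]
    refine add_le_add ?_ ?_
    · rw [one_mul]
      calc (1 : ℝ) = 1 * 1 := by ring
        _ ≤ (n : ℝ) ^ (d - 1 - p) * n := mul_le_mul hpow1 hn1 zero_le_one (by positivity)
    · have h1 : (1 : ℝ) + 4 / δ * n ≤ (1 + 4 / δ) * n := by nlinarith
      calc κ * (F * ((4 / δ) ^ (d - 1 - p) * (n : ℝ) ^ (d - 1 - p)) * (1 + 4 / δ * n))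
          ≤ κ * (F * ((4 / δ) ^ (d - 1 - p) * (n : ℝ) ^ (d - 1 - p)) * ((1 + 4 / δ) * n)) := by gcongr
        _ = κ * (F * (4 / δ) ^ (d - 1 - p) * (1 + 4 / δ)) * ((n : ℝ) ^ (d - 1 - p) * n) := by ring
  calc (q.factorial : ℝ) * ((2 / δ) ^ q * (n : ℝ) ^ q) * (2 * (1 + κ * (F * ((4 / δ) ^ (d - 1 - p) * (n : ℝ) ^ (d - 1 - p)) * (1 + 4 / δ * n))))
      ≤ (q.factorial : ℝ) * ((2 / δ) ^ q * (n : ℝ) ^ q) * (2 * ((1 + κ * (F * (4 / δ) ^ (d - 1 - p) * (1 + 4 / δ))) * (n : ℝ) ^ (d - p))) := by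
        gcongr
    _ = 2 * q.factorial * (2 / δ) ^ q * (1 + κ * (F * (4 / δ) ^ (d - 1 - p) * (1 + 4 / δ))) * ((n : ℝ) ^ (d - p) * (n : ℝ) ^ q) := by ring
    _ = _ := by rw [← pow_add]

/-! ## §2 Packaged kernel∘profile bounds (owner ρ-g10-1 (N2)) -/

/-- [folklore] A profile bound forces a nonnegative constant: `|f x| ≤ A∕nrm(x−v)^b` at `x = v` gives `0 ≤ A`. -/
theorem nonneg_of_profile {f : Site d → ℝ} {A : ℝ} {v : Site d} {b : ℕ} (h : |f v| ≤ A / nrm (v - v) ^ b) : 0 ≤ A := by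
  rw [sub_self, nrm_eq_max, PoissonInterior.supNorm_zero, Nat.cast_zero, max_eq_left (zero_le_one' ℝ), one_pow, div_one] at h
  exact le_trans (abs_nonneg _) h

/-- [folklore] **KERNEL∘PROFILE, SUPER-CRITICAL** (`a, b ≤ d−1`, `a+b ≥ d+1`): if `|K x| ≤ κ∕nrm(x−u)^a` and `|f x| ≤ A∕nrm(x−v)^b` on `S`
(`κ, A ≥ 0`) then `|Σ_{x∈S} K x·f x| ≤ κ·A·(d·2^{d+3}·9^{d−1})∕nrm(u−v)^{a+b−d}` — e.g. (2,3) ↦ `(Ga∇ρ_u)(ξ) ≤ k n⁻²·nrm(ξ−u)⁻¹`,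
(3,3) ↦ `(Ga∇δρ_u)(ξ) ≤ k n⁻²·nrm(ξ−u)⁻²` at `d = 4`. -/
theorem abs_sum_mul_le_of_profiles (hd : 0 < d) {a b : ℕ} (ha : a ≤ d - 1) (hb : b ≤ d - 1) (hab : d + 1 ≤ a + b)
    {K f : Site d → ℝ} {κ A : ℝ} (hκ : 0 ≤ κ) (hA : 0 ≤ A) (S : Finset (Site d)) (u v : Site d)
    (hK : ∀ x ∈ S, |K x| ≤ κ / nrm (x - u) ^ a) (hf : ∀ x ∈ S, |f x| ≤ A / nrm (x - v) ^ b) :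
    |∑ x ∈ S, K x * f x| ≤ κ * A * (d * 2 ^ (d + 3) * 9 ^ (d - 1)) / nrm (u - v) ^ (a + b - d) := by
  have hpt : ∀ x ∈ S, |K x * f x| ≤ κ * A * (1 / (nrm (x - u) ^ a * nrm (x - v) ^ b)) := by
    intro x hx
    have := nrm_pos (x - u); have := nrm_pos (x - v)
    rw [abs_mul]
    calc |K x| * |f x| ≤ κ / nrm (x - u) ^ a * (A / nrm (x - v) ^ b) := mul_le_mul (hK x hx) (hf x hx) (abs_nonneg _) (by positivity)
      _ = κ * A * (1 / (nrm (x - u) ^ a * nrm (x - v) ^ b)) := by rw [mul_one_div, div_mul_div_comm]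
  calc |∑ x ∈ S, K x * f x| ≤ ∑ x ∈ S, |K x * f x| := Finset.abs_sum_le_sum_abs _ _
    _ ≤ ∑ x ∈ S, κ * A * (1 / (nrm (x - u) ^ a * nrm (x - v) ^ b)) := Finset.sum_le_sum hpt
    _ = κ * A * ∑ x ∈ S, 1 / (nrm (x - u) ^ a * nrm (x - v) ^ b) := by rw [Finset.mul_sum]
    _ ≤ κ * A * (d * 2 ^ (d + 3) * 9 ^ (d - 1) / nrm (u - v) ^ (a + b - d)) :=
        mul_le_mul_of_nonneg_left (sum_inv_nrm_pow_mul_le hd ha hb hab S u v) (by positivity)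
    _ = _ := by ring

/-- [folklore] **KERNEL∘PROFILE, CRITICAL, ONE PROFILE DAMPED AT SCALE `n`** (`a, b ≤ d−1`, `a+b = d`, `n ≥ 1`): if `|K x| ≤ κ∕nrm(x−u)^a` and
`|f x| ≤ A·e^{−(δ∕n)‖x−v‖∞}∕nrm(x−v)^b` on `S` (`κ, A ≥ 0`) then `|Σ_{x∈S} K x·f x| ≤ κ·A·3^{d−1}(1 + 2d·3^{d−1})(3 + 2∕δ + log n)` — the damped (3,1)
placement `𝔅(ρ_u,ρ_{u′}) ≤ k n⁻⁴(1 + log n)` at `d = 4`. -/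
theorem abs_sum_mul_le_of_profiles_crit (hd : 0 < d) {a b : ℕ} (ha : a ≤ d - 1) (hb : b ≤ d - 1) (hab : a + b = d)
    {δ : ℝ} (hδ : 0 < δ) {n : ℕ} (hn : 1 ≤ n) {K f : Site d → ℝ} {κ A : ℝ} (hκ : 0 ≤ κ) (hA : 0 ≤ A) (S : Finset (Site d)) (u v : Site d)
    (hK : ∀ x ∈ S, |K x| ≤ κ / nrm (x - u) ^ a) (hf : ∀ x ∈ S, |f x| ≤ A * Real.exp (-(δ / n) * supNorm (x - v)) / nrm (x - v) ^ b) :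
    |∑ x ∈ S, K x * f x| ≤ κ * A * (3 ^ (d - 1) * (1 + 2 * d * 3 ^ (d - 1)) * (3 + 2 / δ + Real.log n)) := by
  have hpt : ∀ x ∈ S, |K x * f x| ≤ κ * A * (Real.exp (-(δ / n) * supNorm (x - v)) / (nrm (x - u) ^ a * nrm (x - v) ^ b)) := by
    intro x hx
    have := nrm_pos (x - u); have := nrm_pos (x - v)
    rw [abs_mul]
    calc |K x| * |f x| ≤ κ / nrm (x - u) ^ a * (A * Real.exp (-(δ / n) * supNorm (x - v)) / nrm (x - v) ^ b) :=
          mul_le_mul (hK x hx) (hf x hx) (abs_nonneg _) (by positivity)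
      _ = κ * A * (Real.exp (-(δ / n) * supNorm (x - v)) / (nrm (x - u) ^ a * nrm (x - v) ^ b)) := by
          rw [div_mul_div_comm]; ring
  calc |∑ x ∈ S, K x * f x| ≤ ∑ x ∈ S, |K x * f x| := Finset.abs_sum_le_sum_abs _ _
    _ ≤ ∑ x ∈ S, κ * A * (Real.exp (-(δ / n) * supNorm (x - v)) / (nrm (x - u) ^ a * nrm (x - v) ^ b)) := Finset.sum_le_sum hpt
    _ = κ * A * ∑ x ∈ S, Real.exp (-(δ / n) * supNorm (x - v)) / (nrm (x - u) ^ a * nrm (x - v) ^ b) := by rw [Finset.mul_sum]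
    _ ≤ _ := mul_le_mul_of_nonneg_left (sum_exp_div_nrm_pow_mul_crit_le hd ha hb hab hδ hn S u v) (by positivity)

/-! ## §3 `Summable` ∕ `tsum` forms (whole lattice `Site d = ℤ^d`) -/

/-- [folklore] A uniform bound on the finite sums of a nonnegative family is a bound on its `tsum`, and the family is summable
(Mathlib's `summable_of_sum_le` ∕ `Real.tsum_le_of_sum_le`, packaged). -/
theorem summable_and_tsum_le_of_sum_le {g : Site d → ℝ} {C : ℝ} (hg : ∀ x, 0 ≤ g x) (h : ∀ S : Finset (Site d), ∑ x ∈ S, g x ≤ C) :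
    Summable g ∧ ∑' x, g x ≤ C :=
  ⟨summable_of_sum_le hg h, Real.tsum_le_of_sum_le hg h⟩

/-- [folklore] A uniform bound `Σ_{x∈S} |h x| ≤ C` makes `h` summable with `|Σ' h| ≤ C`. -/
theorem summable_and_abs_tsum_le_of_abs_sum_le {h : Site d → ℝ} {C : ℝ} (hC : ∀ S : Finset (Site d), ∑ x ∈ S, |h x| ≤ C) :
    Summable h ∧ |∑' x, h x| ≤ C := by
  have habs : Summable fun x => |h x| := summable_of_sum_le (fun x => abs_nonneg _) hC
  have hnorm : Summable fun x => ‖h x‖ := by simpa only [Real.norm_eq_abs] using habs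
  refine ⟨habs.of_abs, ?_⟩
  have h1 : |∑' x, h x| ≤ ∑' x, |h x| := by
    have := norm_tsum_le_tsum_norm hnorm
    simpa only [Real.norm_eq_abs] using this
  exact h1.trans (Real.tsum_le_of_sum_le (fun x => abs_nonneg _) hC)

/-- [folklore] `tsum` form of part 1's super-critical whole-space sum (`p ≥ d+1`): summable, `Σ' ≤ 1 + 4d·3^{d−1}`. -/
theorem tsum_inv_nrm_pow_le (hd : 0 < d) {p : ℕ} (hp : d + 1 ≤ p) (u : Site d) :
    Summable (fun x : Site d => 1 / nrm (x - u) ^ p) ∧ ∑' x : Site d, 1 / nrm (x - u) ^ p ≤ 1 + 4 * d * 3 ^ (d - 1) :=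
  summable_and_tsum_le_of_sum_le (fun x => by have := nrm_pos (x - u); positivity) fun S => sum_inv_nrm_pow_le_const hd hp S u

/-- [folklore] `tsum` form of part 1's damped moments at scale `n`. -/
theorem tsum_pow_mul_exp_scale_le (hd : 0 < d) {δ : ℝ} (hδ : 0 < δ) {n : ℕ} (hn : 1 ≤ n) (q : ℕ) (u : Site d) :
    Summable (fun x : Site d => ((supNorm (x - u) : ℕ) : ℝ) ^ q * Real.exp (-(δ / n) * supNorm (x - u))) ∧
      ∑' x : Site d, ((supNorm (x - u) : ℕ) : ℝ) ^ q * Real.exp (-(δ / n) * supNorm (x - u))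
        ≤ 1 + 2 * d * 3 ^ (d - 1) * ((q + d - 1).factorial * (2 / δ) ^ (q + d - 1) * (1 + 2 / δ)) * (n : ℝ) ^ (q + d) :=
  summable_and_tsum_le_of_sum_le (fun x => by positivity) fun S => sum_pow_mul_exp_scale_le hd hδ hn q S u

/-- [folklore] `tsum` form of part 1's damped critical power at scale `n`. -/
theorem tsum_exp_div_nrm_pow_crit_le (hd : 0 < d) {δ : ℝ} (hδ : 0 < δ) {n : ℕ} (hn : 1 ≤ n) (u : Site d) :
    Summable (fun x : Site d => Real.exp (-(δ / n) * supNorm (x - u)) / nrm (x - u) ^ d) ∧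
      ∑' x : Site d, Real.exp (-(δ / n) * supNorm (x - u)) / nrm (x - u) ^ d ≤ 1 + 2 * d * 3 ^ (d - 1) * (2 + 2 / δ + Real.log n) :=
  summable_and_tsum_le_of_sum_le (fun x => by have := nrm_pos (x - u); positivity) fun S => sum_exp_div_nrm_pow_crit_le hd hδ hn S u

/-- [folklore] `tsum` form of §1's damping-centre-free sum at scale `n`. -/
theorem tsum_pow_mul_exp_div_nrm_pow_free_scale_le (hd : 0 < d) {δ : ℝ} (hδ : 0 < δ) {n : ℕ} (hn : 1 ≤ n) {p : ℕ} (hp : p ≤ d - 1)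
    (q : ℕ) (u v : Site d) :
    Summable (fun x : Site d => ((supNorm (x - v) : ℕ) : ℝ) ^ q * Real.exp (-(δ / n) * supNorm (x - v)) / nrm (x - u) ^ p) ∧
      ∑' x : Site d, ((supNorm (x - v) : ℕ) : ℝ) ^ q * Real.exp (-(δ / n) * supNorm (x - v)) / nrm (x - u) ^ p
        ≤ 2 * q.factorial * (2 / δ) ^ q * (1 + 2 * d * 3 ^ (d - 1) * ((d - 1 - p).factorial * (4 / δ) ^ (d - 1 - p) * (1 + 4 / δ)))
          * (n : ℝ) ^ (d - p + q) :=
  summable_and_tsum_le_of_sum_le (fun x => by have := nrm_pos (x - u); positivity)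
    fun S => sum_pow_mul_exp_div_nrm_pow_free_scale_le hd hδ hn hp q S u v

/-- [folklore] `tsum` form of part 2's lattice HLS inequality (two centres, super-critical). -/
theorem tsum_inv_nrm_pow_mul_le (hd : 0 < d) {a b : ℕ} (ha : a ≤ d - 1) (hb : b ≤ d - 1) (hab : d + 1 ≤ a + b) (u v : Site d) :
    Summable (fun x : Site d => 1 / (nrm (x - u) ^ a * nrm (x - v) ^ b)) ∧
      ∑' x : Site d, 1 / (nrm (x - u) ^ a * nrm (x - v) ^ b) ≤ d * 2 ^ (d + 3) * 9 ^ (d - 1) / nrm (u - v) ^ (a + b - d) :=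
  summable_and_tsum_le_of_sum_le (fun x => by have := nrm_pos (x - u); have := nrm_pos (x - v); positivity)
    fun S => sum_inv_nrm_pow_mul_le hd ha hb hab S u v

/-- [folklore] `tsum` form of part 2's critical damped two-centre sum. -/
theorem tsum_exp_div_nrm_pow_mul_crit_le (hd : 0 < d) {a b : ℕ} (ha : a ≤ d - 1) (hb : b ≤ d - 1) (hab : a + b = d)
    {δ : ℝ} (hδ : 0 < δ) {n : ℕ} (hn : 1 ≤ n) (u v : Site d) :
    Summable (fun x : Site d => Real.exp (-(δ / n) * supNorm (x - v)) / (nrm (x - u) ^ a * nrm (x - v) ^ b)) ∧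
      ∑' x : Site d, Real.exp (-(δ / n) * supNorm (x - v)) / (nrm (x - u) ^ a * nrm (x - v) ^ b)
        ≤ 3 ^ (d - 1) * (1 + 2 * d * 3 ^ (d - 1)) * (3 + 2 / δ + Real.log n) :=
  summable_and_tsum_le_of_sum_le (fun x => by have := nrm_pos (x - u); have := nrm_pos (x - v); positivity)
    fun S => sum_exp_div_nrm_pow_mul_crit_le hd ha hb hab hδ hn S u v

/-- [folklore] **`tsum` KERNEL∘PROFILE, SUPER-CRITICAL** — the sharp twin of FP's `tsum_kernel_profile_le` ∕ `abs_tsum_mul_le_of_profiles`: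
profiles on ALL of `ℤ^d` ⇒ `K·f` summable and `|Σ' K·f| ≤ κ·A·(d·2^{d+3}·9^{d−1})∕nrm(u−v)^{a+b−d}`. -/
theorem abs_tsum_mul_le_of_profiles (hd : 0 < d) {a b : ℕ} (ha : a ≤ d - 1) (hb : b ≤ d - 1) (hab : d + 1 ≤ a + b)
    {K f : Site d → ℝ} {κ A : ℝ} (u v : Site d)
    (hK : ∀ x, |K x| ≤ κ / nrm (x - u) ^ a) (hf : ∀ x, |f x| ≤ A / nrm (x - v) ^ b) :
    Summable (fun x => K x * f x) ∧ |∑' x, K x * f x| ≤ κ * A * (d * 2 ^ (d + 3) * 9 ^ (d - 1)) / nrm (u - v) ^ (a + b - d) := by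
  have hκ : 0 ≤ κ := nonneg_of_profile (hK u)
  have hA : 0 ≤ A := nonneg_of_profile (hf v)
  refine summable_and_abs_tsum_le_of_abs_sum_le fun S => ?_
  have h := abs_sum_mul_le_of_profiles hd ha hb hab (K := fun x => |K x|) (f := fun x => |f x|) hκ hA S u v
    (fun x _ => by rw [abs_abs]; exact hK x) (fun x _ => by rw [abs_abs]; exact hf x)
  refine le_trans (le_of_eq (Finset.sum_congr rfl fun x _ => ?_)) (le_trans (le_abs_self _) h)
  rw [abs_mul]

/-- [folklore] **`tsum` KERNEL∘PROFILE, CRITICAL, DAMPED** (`a+b = d`, the `f`-profile damped at scale `n`): `K·f` summable and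
`|Σ' K·f| ≤ κ·A·3^{d−1}(1 + 2d·3^{d−1})(3 + 2∕δ + log n)`. -/
theorem abs_tsum_mul_le_of_profiles_crit (hd : 0 < d) {a b : ℕ} (ha : a ≤ d - 1) (hb : b ≤ d - 1) (hab : a + b = d)
    {δ : ℝ} (hδ : 0 < δ) {n : ℕ} (hn : 1 ≤ n) {K f : Site d → ℝ} {κ A : ℝ} (hA : 0 ≤ A) (u v : Site d)
    (hK : ∀ x, |K x| ≤ κ / nrm (x - u) ^ a) (hf : ∀ x, |f x| ≤ A * Real.exp (-(δ / n) * supNorm (x - v)) / nrm (x - v) ^ b) :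
    Summable (fun x => K x * f x) ∧ |∑' x, K x * f x| ≤ κ * A * (3 ^ (d - 1) * (1 + 2 * d * 3 ^ (d - 1)) * (3 + 2 / δ + Real.log n)) := by
  have hκ : 0 ≤ κ := nonneg_of_profile (hK u)
  refine summable_and_abs_tsum_le_of_abs_sum_le fun S => ?_
  have h := abs_sum_mul_le_of_profiles_crit hd ha hb hab hδ hn (K := fun x => |K x|) (f := fun x => |f x|) hκ hA S u v
    (fun x _ => by rw [abs_abs]; exact hK x) (fun x _ => by rw [abs_abs]; exact hf x)
  refine le_trans (le_of_eq (Finset.sum_congr rfl fun x _ => ?_)) (le_trans (le_abs_self _) h)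
  rw [abs_mul]

/-! ## §4 The `d = 4` reading for the road's `Pt` letters -/

/-- [folklore] The road's integer sup-norm on `Pt = ℤ⁴` (`DyadicShell.supNorm`) IS `PoissonInterior.supNorm` at `d = 4`. -/
theorem supNorm_dyadic (w : DyadicShell.Pt) : DyadicShell.supNorm w = supNorm (d := 4) w := rfl

/-- [folklore] Off the origin the regularised norm is the sup-norm: `nrm w = ‖w‖∞` for `w ≠ 0`. -/
theorem nrm_eq_supNorm_of_ne_zero (w : DyadicShell.Pt) (hw : w ≠ 0) : nrm (d := 4) w = (DyadicShell.supNorm w : ℝ) := by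
  rw [nrm_eq_max, ← supNorm_dyadic]
  exact max_eq_right (by exact_mod_cast DyadicShell.supNorm_pos hw)

/-- [folklore] **THE ROAD's LETTERS ARE PROFILES.**  A `Pt`-letter of the shape `|g v| ≤ A·e^{−(δ∕n)‖v‖∞}∕‖v‖∞^p` for `v ≠ 0`
(`GhostLegFree.ghost_d0∕d1`, `FrozenLegTails`) together with a diagonal value `|g 0| ≤ A` (A ≥ 0) is the damped profile
`|g v| ≤ A·e^{−(δ∕n)‖v‖∞}∕nrm(v)^p` at EVERY `v` — the hypothesis shape of §2 ∕ §3 (with `u = 0`, `x − 0 = x`). -/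
theorem profile_of_letter {g : DyadicShell.Pt → ℝ} {A δ : ℝ} {n p : ℕ} (hA : |g 0| ≤ A)
    (h : ∀ v : DyadicShell.Pt, v ≠ 0 → |g v| ≤ A * Real.exp (-(δ / n) * DyadicShell.supNorm v) / (DyadicShell.supNorm v : ℝ) ^ p)
    (v : DyadicShell.Pt) : |g v| ≤ A * Real.exp (-(δ / n) * supNorm (d := 4) v) / nrm (d := 4) v ^ p := by
  by_cases hv : v = 0
  · subst hv
    rw [nrm_eq_max, PoissonInterior.supNorm_zero, Nat.cast_zero, mul_zero, Real.exp_zero, mul_one, max_eq_left (zero_le_one' ℝ),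
      one_pow, div_one]
    exact hA
  · rw [nrm_eq_supNorm_of_ne_zero v hv, supNorm_dyadic]
    exact h v hv

end Summit.QuantumFields.BalabanUV.Beta.D1BFx.LatticeHLSProfiles
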